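import Mathlib.RingTheory.Smooth.StandardSmoothOfFree
import Mathlib.RingTheory.Smooth.Basic
import Mathlib.RingTheory.Etale.Kaehler
import Mathlib.RingTheory.Kaehler.Basic
import Mathlib.Algebra.MvPolynomial.PDeriv
import Mathlib.RingTheory.FinitePresentation
import Mathlib.RingTheory.Finiteness.Nakayama
import Mathlib.LinearAlgebra.Matrix.NonsingularInverse
import Mathlib.RingTheory.Localization.Away.Basic
import Literature.AlgebraicGeometry.Resolution.NeronPopescuLocalTricks
import Literature.AlgebraicGeometry.Resolution.NeronPopescuLiftingProblem
import HarnessLib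

/-!
# Stacks 07CH / 07CI: a smooth algebra is a retract of a standard smooth algebra

Topic: `Literature/AlgebraicGeometry/Resolution`. The Stacks Project, *Smoothing Ring Maps*
(Tag 07BW), §16.3 "Presentations of algebras":

> **Lemma 07CH.** Let `R → A` be a smooth ring map. Then there exists a smooth `R`-algebra map
> `A → B` with a retraction such that `B` is standard smooth over `R`, i.e.,
> `B ≅ R[x_1, …, x_n]/(f_1, …, f_c)` and `det(∂f_j/∂x_i)_{i,j = 1, …, c}` is invertible in
> `B`.
>
> **Lemma 07CI.** Let `R → Λ` be a ring map. If `Λ` is a filtered colimit of smooth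
> `R`-algebras, then `Λ` is a filtered colimit of standard smooth `R`-algebras.
> *Proof.* Let `A → Λ` be an `R`-algebra map with `A` of finite presentation over `R`.
> According to Algebra, Lemma 07C3 we have to factor this map through a standard smooth
> algebra, and we know we can factor it as `A → B → Λ` with `B` smooth over `R`. Choose an
> `R`-algebra map `B → C` with a retraction `C → B` such that `C` is standard smooth over `R`,
> see Lemma 07CH. Then the desired factorization is `A → B → C → B → Λ`.

Main results (sorry-free, no named facts):

* `exists_isStandardSmooth_retract_of_smooth` — **07CH** in retract form: for `B` smooth over
  `R` (Mathlib `Algebra.Smooth`) there are a standard smooth `R`-algebra `S` (Mathlib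
  `Algebra.IsStandardSmooth`) and `R`-algebra maps `ι : B → S`, `ρ : S → B` with `ρ ∘ ι = id`.
* `hasStandardSmoothFactorizations_of_hasSmoothFactorizations` — **07CI** in the factorisation
  form of Algebra, Lemma 07C3 (2): `HasSmoothFactorizations R Λ → HasStandardSmoothFactorizations
  R Λ` (`NeronPopescuSingularIdeal.lean`, `NeronPopescuLiftingProblem.lean`). This is hypothesis
  `hCI` of `Stacks07F5_reduceToField_of` (`NeronPopescuReduceToField.lean`).

## The proof of 07CH formalised here

Stacks proves 07CH through Lemma 07CG (a syntomic algebra is a retract of a relative global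
complete intersection, via the symmetric algebra `Sym(I/I²)` of Lemma 07CD), a twist
`z_i = x_i - Σ_j c_{ij} y_j` of the coordinates of `C[y_1, …, y_c]`, Nakayama's lemma to get
`R[z] → C[y]_g` unramified for some `g ∈ 1 + (y)`, the critère de platitude par fibres to get
it étale, and the structure of étale algebras (Algebra, Lemma 00UE) to conclude. We keep the
architecture "symmetric algebra of a vector bundle — twisted coordinates `z` — Nakayama —
localise at `g ∈ 1 + (y)`" but replace the last two inputs (fibrewise flatness, structure of
étale algebras), which Mathlib lacks, by Mathlib's presentation-free characterisation of
standard smoothness, `Algebra.IsStandardSmooth.of_basis_kaehlerDifferential`: a finitely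
presented `S` with `H¹(L_{S/R}) = 0` and `Ω_{S/R}` free on a family of *exact* differentials
`d s_i` is standard smooth. Concretely, for `B` smooth over `R` with generators `x_1, …, x_n`:

1. `π : B^n → Ω_{B/R}`, `e_j ↦ dx_j`, is surjective and `Ω_{B/R}` is projective, so `π` has a
   section `σ`; put `P_{ij} = σ(dx_j)_i` (an idempotent matrix, `Σ_i P_{im} dx_i = dx_m`) and
   `∂_i = σ(d(-))_i ∈ Der_R(B, B)` (so `db = Σ_i ∂_i(b) dx_i`, `∂_i(x_j) = P_{ij}`)
   (`Stacks07CH.projMat`, `Stacks07CH.coordDeriv`).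
2. `C = B[y_1, …, y_n]/(Σ_l P_{lm} y_l ; m)` — the symmetric algebra of the direct summand
   `K = ker π ≅ im(1 - P)` of `B^n`, the analogue of the algebra `Sym(I/I²)`/`C[y_1, …, y_c]` of
   07CD/07CH — is a retract of `B[y]` (`y_j ↦ y_j - Σ_l P_{lj} y_l`), hence smooth over `B` and
   over `R`, with augmentation `ε : C → B`, `y ↦ 0` (`Stacks07CH.SymK`, `.retractLift`,
   `.augment`).
3. `z_j = x_j + y_j ∈ C` (the twisted coordinates). The `R`-derivations
   `D_i = q ∘ (∂_i ⊗ 1 + ∂/∂y_i) ∘ φ̄` of `C` (through the retraction) satisfy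
   `ε(D_i z_j) = δ_{ij}` (`Stacks07CH.symKDeriv`, `.augment_det_ZMat`), and
   `Ω_{C/R} = Σ_j C dz_j + (y) Ω_{C/R}` (`Stacks07CH.mem_dzSpan_sup`: from `dx_m = Σ P_{im} dx_i`
   and `d(Σ_l P_{lm} y_l) = 0`), so by Nakayama some `r ∈ 1 + ker ε` has
   `r Ω_{C/R} ⊆ Σ_j C dz_j` (`Stacks07CH.exists_augment_eq_one_and_smul_mem`).
4. `S = C_g`, `g = r · det(D_i z_j)`: the `d(z_j)` span `Ω_{S/R}` (as `r` is a unit) and are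
   linearly independent (apply the `S`-linear extensions of the `D_i`, available because
   `Ω_{S/R} = S ⊗_C Ω_{C/R}` for the localisation, and invert `det(D_i z_j)`); `S` is smooth,
   so `H¹(L_{S/R}) = 0` and Mathlib's criterion makes `S` standard smooth; `ε(g) = 1`, so `ε`
   extends to the retraction `ρ : S → B` (`Stacks07CH.Sg.isStandardSmooth`, `.retractionSg`).

Tools proved on the way: derivations applied coefficientwise to `MvPolynomial`
(`coeffwiseDerivation`), derivations of a retract (`retractDerivation`), and "the `d f(X_i)`
span `Ω_{B/R}` for a surjection `f : R[X] → B`" (`span_range_D_eq_top_of_surjective`).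

## References

* The Stacks Project, *Smoothing Ring Maps* (Tag 07BW): Lemmas 07CH, 07CI and their proofs;
  Lemmas 07CD, 07CG; *Algebra*, Lemma 07C3. [StacksProject]
* Mathlib, `Mathlib/RingTheory/Smooth/StandardSmoothOfFree.lean`
  (`Algebra.IsStandardSmooth.of_basis_kaehlerDifferential`).
-/

noncomputable section

open MvPolynomial

namespace Literature.AlgebraicGeometry.Resolution

universe u

/-! ## Tool 1: coefficientwise derivations of polynomial rings -/

section CoeffDerivation

variable {R : Type*} [CommRing R] {B : Type*} [CommRing B] [Algebra R B] {ι : Type*}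

/-- An additive self-map `δ` of `B` applied to the coefficients of polynomials over `B`, as an
`R`-linear map when `δ` is `R`-linear. [folklore] -/
def coeffMapₗ (δ : B →ₗ[R] B) : MvPolynomial ι B →ₗ[R] MvPolynomial ι B where
  toFun f := AddMonoidAlgebra.map δ.toAddMonoidHom f
  map_add' f g := AddMonoidAlgebra.map_add _ f g
  map_smul' r f := by
    refine MvPolynomial.ext _ _ fun m => ?_
    rw [coeff_addMonoidAlgebraMap, coeff_smul, RingHom.id_apply, coeff_smul,
      coeff_addMonoidAlgebraMap]
    exact map_smul δ r (coeff m f)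

/-- Coefficients of `coeffMapₗ δ f`. [folklore] -/
theorem coeff_coeffMapₗ (δ : B →ₗ[R] B) (f : MvPolynomial ι B) (m : ι →₀ ℕ) :
    coeff m (coeffMapₗ δ f) = δ (coeff m f) :=
  coeff_addMonoidAlgebraMap _ f m

/-- `coeffMapₗ` on monomials. [folklore] -/
theorem coeffMapₗ_monomial (δ : B →ₗ[R] B) (s : ι →₀ ℕ) (b : B) :
    coeffMapₗ (ι := ι) δ (monomial s b) = monomial s (δ b) :=
  AddMonoidAlgebra.map_single _ b s

/-- The Leibniz rule for a derivation applied coefficientwise. [folklore] -/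
theorem coeffMapₗ_mul (δ : Derivation R B B) (f g : MvPolynomial ι B) :
    coeffMapₗ (ι := ι) (δ : B →ₗ[R] B) (f * g) =
      f * coeffMapₗ (δ : B →ₗ[R] B) g + g * coeffMapₗ (δ : B →ₗ[R] B) f := by
  induction f using MvPolynomial.induction_on' with
  | monomial s a =>
    induction g using MvPolynomial.induction_on' with
    | monomial t b =>
      rw [monomial_mul, coeffMapₗ_monomial, coeffMapₗ_monomial, coeffMapₗ_monomial, monomial_mul,
        monomial_mul, Derivation.coeFn_coe, δ.leibniz, smul_eq_mul, smul_eq_mul, map_add,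
        add_comm t s]
    | add g₁ g₂ h₁ h₂ => rw [mul_add, map_add, h₁, h₂, map_add, mul_add, add_mul]; abel
  | add f₁ f₂ h₁ h₂ => rw [add_mul, map_add, h₁, h₂, map_add, mul_add, add_mul]; abel

/-- An `R`-derivation `δ` of `B`, applied to the coefficients of polynomials over `B`, is an
`R`-derivation of the polynomial ring. [folklore] -/
def coeffwiseDerivation (δ : Derivation R B B) :
    Derivation R (MvPolynomial ι B) (MvPolynomial ι B) where
  toLinearMap := coeffMapₗ (δ : B →ₗ[R] B)
  map_one_eq_zero' := by
    change coeffMapₗ (ι := ι) (δ : B →ₗ[R] B) (monomial 0 1) = 0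
    rw [coeffMapₗ_monomial, Derivation.coeFn_coe, δ.map_one_eq_zero, map_zero]
  leibniz' f g := by
    change coeffMapₗ (ι := ι) (δ : B →ₗ[R] B) (f * g) = _
    rw [coeffMapₗ_mul, smul_eq_mul, smul_eq_mul]

/-- `coeffwiseDerivation` on monomials. [folklore] -/
theorem coeffwiseDerivation_monomial (δ : Derivation R B B) (s : ι →₀ ℕ) (b : B) :
    coeffwiseDerivation (ι := ι) δ (monomial s b) = monomial s (δ b) :=
  coeffMapₗ_monomial _ s b

/-- `coeffwiseDerivation` on constants. [folklore] -/
@[simp]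
theorem coeffwiseDerivation_C (δ : Derivation R B B) (b : B) :
    coeffwiseDerivation (ι := ι) δ (C b) = C (δ b) :=
  coeffMapₗ_monomial _ 0 b

/-- `coeffwiseDerivation` kills the variables. [folklore] -/
@[simp]
theorem coeffwiseDerivation_X (δ : Derivation R B B) (i : ι) :
    coeffwiseDerivation (ι := ι) δ (X i) = 0 := by
  change coeffwiseDerivation (ι := ι) δ (monomial (Finsupp.single i 1) 1) = 0
  rw [coeffwiseDerivation_monomial, δ.map_one_eq_zero, map_zero]

end CoeffDerivation

/-! ## Tool 2: derivations of a retract -/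

section RetractDerivation

variable {R C T : Type*} [CommSemiring R] [CommRing C] [CommRing T] [Algebra R C] [Algebra R T]

/-- An `R`-derivation `D` of `T` induces the `R`-derivation `q ∘ D ∘ i` of a retract
`i : C → T`, `q : T → C`, `q ∘ i = id`. [folklore] -/
def retractDerivation (D : Derivation R T T) (i : C →ₐ[R] T) (q : T →ₐ[R] C)
    (h : ∀ c, q (i c) = c) : Derivation R C C where
  toLinearMap := q.toLinearMap ∘ₗ (D : T →ₗ[R] T) ∘ₗ i.toLinearMap
  map_one_eq_zero' := by simp
  leibniz' a b := by
    simp only [LinearMap.coe_comp, Function.comp_apply, AlgHom.toLinearMap_apply,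
      Derivation.coeFn_coe, map_mul, Derivation.leibniz, smul_eq_mul, map_add, h]

/-- `retractDerivation D i q h c = q (D (i c))`. [folklore] -/
theorem retractDerivation_apply (D : Derivation R T T) (i : C →ₐ[R] T) (q : T →ₐ[R] C)
    (h : ∀ c, q (i c) = c) (c : C) : retractDerivation D i q h c = q (D (i c)) := rfl

end RetractDerivation

/-! ## Tool 3: differentials of algebra generators span `Ω` -/

section SpanTool

variable {R B : Type*} [CommRing R] [CommRing B] [Algebra R B] {ι : Type*}

/-- If `f : R[X_ι] → B` is surjective then the `d f(X_i)` span `Ω_{B/R}`. [folklore] -/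
theorem span_range_D_eq_top_of_surjective (f : MvPolynomial ι R →ₐ[R] B)
    (hf : Function.Surjective f) :
    Submodule.span B (Set.range fun i => KaehlerDifferential.D R B (f (X i))) = ⊤ := by
  apply top_le_iff.mp
  rw [← KaehlerDifferential.span_range_derivation, Submodule.span_le]
  rintro _ ⟨b, rfl⟩
  obtain ⟨p, rfl⟩ := hf b
  induction p using MvPolynomial.induction_on with
  | C r =>
    rw [MvPolynomial.algHom_C, Derivation.map_algebraMap]
    exact zero_mem _
  | add p q hp hq => rw [map_add, map_add]; exact add_mem hp hq
  | mul_X p i hp =>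
    rw [map_mul, Derivation.leibniz]
    exact add_mem (Submodule.smul_mem _ _ (Submodule.subset_span ⟨i, rfl⟩))
      (Submodule.smul_mem _ _ hp)

end SpanTool

/-! ## The construction: coordinates on a smooth algebra -/

namespace Stacks07CH

section Coordinates

open KaehlerDifferential

variable {R : Type u} [CommRing R] {B : Type u} [CommRing B] [Algebra R B] {n : ℕ}
  (x : Fin n → B) (σ : Ω[B⁄R] →ₗ[B] (Fin n → B))

/-- The matrix `P_{ij} = σ(dx_j)_i` of `σ ∘ π`, where `π(e_j) = dx_j`. [cite: StacksProject, Tag 07CH (proof)] -/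
def projMat : Matrix (Fin n) (Fin n) B := Matrix.of fun i j => σ (D R B (x j)) i

/-- Entries of `P`. [cite: StacksProject, Tag 07CH (proof)] -/
theorem projMat_apply (i j : Fin n) : projMat x σ i j = σ (D R B (x j)) i := rfl

/-- The `R`-derivations `∂_i = (σ ∘ d)_i` of `B`. [cite: StacksProject, Tag 07CH (proof)] -/
def coordDeriv (i : Fin n) : Derivation R B B :=
  ((LinearMap.proj i).comp σ).compDer (D R B)

/-- `∂_i(b) = σ(db)_i`. [cite: StacksProject, Tag 07CH (proof)] -/
@[simp]
theorem coordDeriv_apply (i : Fin n) (b : B) : coordDeriv σ i b = σ (D R B b) i := rfl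

/-- `∂_i(x_j) = P_{ij}`. [cite: StacksProject, Tag 07CH (proof)] -/
theorem coordDeriv_x (i j : Fin n) : coordDeriv σ i (x j) = projMat x σ i j := rfl

variable (hσ : ∀ ω, ∑ i, σ ω i • D R B (x i) = ω)
include hσ

/-- `db = Σ_i ∂_i(b) dx_i`. [cite: StacksProject, Tag 07CH (proof)] -/
theorem D_eq_sum_coordDeriv (b : B) : D R B b = ∑ i, coordDeriv σ i b • D R B (x i) :=
  (hσ _).symm

/-- `dx_m = Σ_i P_{im} dx_i` (the columns of `1 - P` are relations among the `dx_i`).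
[cite: StacksProject, Tag 07CH (proof)] -/
theorem D_x_eq_sum (m : Fin n) : D R B (x m) = ∑ i, projMat x σ i m • D R B (x i) :=
  (hσ _).symm

/-- `P² = P`. [cite: StacksProject, Tag 07CH (proof)] -/
theorem projMat_mul_self : projMat x σ * projMat x σ = projMat x σ := by
  ext i j
  rw [Matrix.mul_apply]
  have h := congrArg (fun ω => σ ω i) (hσ (D R B (x j)))
  simp only [map_sum, map_smul, Finset.sum_apply, Pi.smul_apply, smul_eq_mul] at h
  rw [projMat_apply, ← h]
  refine Finset.sum_congr rfl fun l _ => ?_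
  rw [projMat_apply, projMat_apply, mul_comm]

end Coordinates

/-! ## The algebra `C = B[y_1, …, y_n]/(Σ_l P_{lm} y_l)` (`= Sym_B(K)`) -/

section Algebra

open KaehlerDifferential

variable {R : Type u} [CommRing R] {B : Type u} [CommRing B] [Algebra R B] {n : ℕ}
  (x : Fin n → B) (σ : Ω[B⁄R] →ₗ[B] (Fin n → B))

/-- The linear form `Σ_l v_l y_l` attached to a vector `v ∈ B^n`. [cite: StacksProject, Tag 07CH (proof)] -/
def linForm : (Fin n → B) →ₗ[B] MvPolynomial (Fin n) B :=
  Fintype.linearCombination B fun l => X l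

/-- `linForm v = Σ_l v_l y_l`. [folklore] -/
theorem linForm_apply (v : Fin n → B) :
    linForm v = ∑ l, v l • (X l : MvPolynomial (Fin n) B) := by
  rw [linForm, Fintype.linearCombination_apply]

/-- The ideal of relations `Σ_l P_{lm} y_l`, `m = 1, …, n`. [cite: StacksProject, Tag 07CH (proof)] -/
def relIdeal : Ideal (MvPolynomial (Fin n) B) :=
  Ideal.span (Set.range fun m => linForm fun l => projMat x σ l m)

/-- The defining relations lie in the ideal. [cite: StacksProject, Tag 07CH (proof)] -/
theorem linForm_col_mem_relIdeal (m : Fin n) :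
    linForm (fun l => projMat x σ l m) ∈ relIdeal x σ :=
  Ideal.subset_span ⟨m, rfl⟩

/-- The ideal of relations is finitely generated. [cite: StacksProject, Tag 07CH (proof)] -/
theorem relIdeal_fg : (relIdeal x σ).FG :=
  Submodule.fg_span (Set.finite_range _)

/-- The algebra `C = B[y_1, …, y_n]/(Σ_l P_{lm} y_l ; m)`, i.e. the symmetric algebra of the
direct summand `K = ker(e_j ↦ dx_j)` of `B^n`. [cite: StacksProject, Tag 07CH (proof)] -/
def SymK : Type u := MvPolynomial (Fin n) B ⧸ relIdeal x σ

/-- `C` is a commutative ring. -/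
instance : CommRing (SymK x σ) := inferInstanceAs (CommRing (_ ⧸ relIdeal x σ))

/-- `C` is a `B`-algebra. -/
instance : Algebra B (SymK x σ) := inferInstanceAs (Algebra B (_ ⧸ relIdeal x σ))

/-- `C` is an `R`-algebra. -/
instance : Algebra R (SymK x σ) := inferInstanceAs (Algebra R (_ ⧸ relIdeal x σ))

/-- `R → B → C` is a scalar tower. -/
instance : IsScalarTower R B (SymK x σ) := inferInstanceAs (IsScalarTower R B (_ ⧸ relIdeal x σ))

/-- `C` is a `B[y]`-algebra. -/
instance : Algebra (MvPolynomial (Fin n) B) (SymK x σ) :=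
  inferInstanceAs (Algebra (MvPolynomial (Fin n) B) (_ ⧸ relIdeal x σ))

/-- `B → B[y] → C` is a scalar tower. -/
instance : IsScalarTower B (MvPolynomial (Fin n) B) (SymK x σ) :=
  inferInstanceAs (IsScalarTower B (MvPolynomial (Fin n) B) (_ ⧸ relIdeal x σ))

/-- `R → B[y] → C` is a scalar tower. -/
instance : IsScalarTower R (MvPolynomial (Fin n) B) (SymK x σ) :=
  inferInstanceAs (IsScalarTower R (MvPolynomial (Fin n) B) (_ ⧸ relIdeal x σ))

/-- The quotient map `q : B[y] → C`. [cite: StacksProject, Tag 07CH (proof)] -/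
def SymK.mkₐ : MvPolynomial (Fin n) B →ₐ[B] SymK x σ := Ideal.Quotient.mkₐ B (relIdeal x σ)

/-- `q` is surjective. [folklore] -/
theorem SymK.mkₐ_surjective : Function.Surjective (SymK.mkₐ x σ) :=
  Ideal.Quotient.mkₐ_surjective B _

/-- `q` kills the relations. [folklore] -/
theorem SymK.mkₐ_eq_zero_of_mem {f : MvPolynomial (Fin n) B} (hf : f ∈ relIdeal x σ) :
    SymK.mkₐ x σ f = 0 :=
  Ideal.Quotient.eq_zero_iff_mem.mpr hf

/-- `B → C` is `q ∘ C`. [folklore] -/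
theorem SymK.algebraMap_eq (b : B) : algebraMap B (SymK x σ) b = SymK.mkₐ x σ (C b) := rfl

/-- The variables `y_j ∈ C`. [cite: StacksProject, Tag 07CH (proof)] -/
def yC (j : Fin n) : SymK x σ := SymK.mkₐ x σ (X j)

/-- The elements `x_j ∈ C`. [cite: StacksProject, Tag 07CH (proof)] -/
def xC (j : Fin n) : SymK x σ := algebraMap B (SymK x σ) (x j)

/-- The elements `z_j = x_j + y_j ∈ C` whose differentials will be the basis (the twisted
coordinates `z_i = x_i - Σ c_{ij} y_j` of the proof of 07CH). [cite: StacksProject, Tag 07CH (proof)] -/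
def zC (j : Fin n) : SymK x σ := xC x σ j + yC x σ j

/-- `z_j = q(x_j + y_j)`. [cite: StacksProject, Tag 07CH (proof)] -/
theorem zC_eq (j : Fin n) : zC x σ j = SymK.mkₐ x σ (C (x j) + X j) := by
  rw [zC, xC, yC, map_add, SymK.algebraMap_eq]

/-- The relation `Σ_l P_{lm} y_l = 0` in `C`. [cite: StacksProject, Tag 07CH (proof)] -/
theorem sum_projMat_smul_yC (m : Fin n) : ∑ l, projMat x σ l m • yC x σ l = 0 := by
  have h := SymK.mkₐ_eq_zero_of_mem x σ (linForm_col_mem_relIdeal x σ m)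
  rw [linForm_apply, map_sum] at h
  simpa only [map_smul, yC] using h

/-! ### `C` is a retract of `B[y]` -/

/-- The endomorphism `φ : y_j ↦ y_j - Σ_l P_{lj} y_l` of `B[y]`. [cite: StacksProject, Tag 07CH (proof)] -/
def retractEndo : MvPolynomial (Fin n) B →ₐ[B] MvPolynomial (Fin n) B :=
  MvPolynomial.aeval fun j => X j - linForm fun l => projMat x σ l j

/-- `φ(y_j) = y_j - Σ_l P_{lj} y_l`. [cite: StacksProject, Tag 07CH (proof)] -/
theorem retractEndo_X (j : Fin n) :
    retractEndo x σ (X j) = X j - linForm fun l => projMat x σ l j :=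
  MvPolynomial.aeval_X _ j

/-- `φ(Σ v_l y_l) = Σ v_l y_l - Σ (Pv)_l y_l`. [cite: StacksProject, Tag 07CH (proof)] -/
theorem retractEndo_linForm (v : Fin n → B) :
    retractEndo x σ (linForm v) = linForm v - linForm ((projMat x σ).mulVec v) := by
  simp only [linForm_apply, map_sum, map_smul, retractEndo_X, smul_sub, Finset.sum_sub_distrib]
  congr 1
  simp only [Finset.smul_sum, Matrix.mulVec, dotProduct, Finset.sum_smul, smul_smul]
  rw [Finset.sum_comm]
  refine Finset.sum_congr rfl fun i _ => Finset.sum_congr rfl fun l _ => ?_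
  rw [mul_comm]

variable (hσ : ∀ ω, ∑ i, σ ω i • D R B (x i) = ω)

section
include hσ

/-- `φ` kills the relations (`P² = P`). [cite: StacksProject, Tag 07CH (proof)] -/
theorem retractEndo_linForm_col (m : Fin n) :
    retractEndo x σ (linForm fun l => projMat x σ l m) = 0 := by
  rw [retractEndo_linForm, sub_eq_zero]
  congr 1
  funext i
  have h := congrArg (fun M : Matrix (Fin n) (Fin n) B => M i m) (projMat_mul_self x σ hσ)
  simp only [Matrix.mul_apply] at h
  rw [Matrix.mulVec, dotProduct]
  exact h.symm

/-- `φ` kills the ideal of relations. [cite: StacksProject, Tag 07CH (proof)] -/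
theorem retractEndo_mem (f : MvPolynomial (Fin n) B) (hf : f ∈ relIdeal x σ) :
    retractEndo x σ f = 0 := by
  refine Submodule.span_induction ?_ (map_zero _) (fun a b _ _ ha hb => by rw [map_add, ha, hb, add_zero])
    (fun a b _ hb => by rw [smul_eq_mul, map_mul, hb, mul_zero]) hf
  rintro _ ⟨m, rfl⟩
  exact retractEndo_linForm_col x σ hσ m

/-- The map `φ̄ : C → B[y]` induced by `φ`. [cite: StacksProject, Tag 07CH (proof)] -/
def retractLift : SymK x σ →ₐ[B] MvPolynomial (Fin n) B :=
  Ideal.Quotient.liftₐ (relIdeal x σ) (retractEndo x σ) (retractEndo_mem x σ hσ)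

/-- `φ̄ ∘ q = φ`. [cite: StacksProject, Tag 07CH (proof)] -/
theorem retractLift_mk (f : MvPolynomial (Fin n) B) :
    retractLift x σ hσ (SymK.mkₐ x σ f) = retractEndo x σ f := rfl

end

/-- `q ∘ φ = q`. [cite: StacksProject, Tag 07CH (proof)] -/
theorem mkₐ_comp_retractEndo : (SymK.mkₐ x σ).comp (retractEndo x σ) = SymK.mkₐ x σ := by
  refine MvPolynomial.algHom_ext fun j => ?_
  rw [AlgHom.comp_apply, retractEndo_X, map_sub, SymK.mkₐ_eq_zero_of_mem x σ
    (linForm_col_mem_relIdeal x σ j), sub_zero]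

section
include hσ

/-- `q ∘ φ̄ = id` (pointwise). [cite: StacksProject, Tag 07CH (proof)] -/
theorem mkₐ_retractLift (c : SymK x σ) : SymK.mkₐ x σ (retractLift x σ hσ c) = c := by
  obtain ⟨f, rfl⟩ := SymK.mkₐ_surjective x σ c
  rw [retractLift_mk]
  exact AlgHom.congr_fun (mkₐ_comp_retractEndo x σ) f

/-- `q ∘ φ̄ = id`: `C` is a retract of `B[y]`. [cite: StacksProject, Tag 07CH (proof)] -/
theorem mkₐ_comp_retractLift : (SymK.mkₐ x σ).comp (retractLift x σ hσ) = AlgHom.id B _ :=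
  AlgHom.ext (mkₐ_retractLift x σ hσ)

/-- `C` is formally smooth over `B` (a retract of a polynomial ring). [cite: StacksProject, Tag 07CH (proof)] -/
theorem SymK.formallySmooth : Algebra.FormallySmooth B (SymK x σ) :=
  formallySmooth_of_retract (retractLift x σ hσ) (SymK.mkₐ x σ) (mkₐ_comp_retractLift x σ hσ)

end

/-- `C` is of finite presentation over `B`. -/
instance SymK.finitePresentation : Algebra.FinitePresentation B (SymK x σ) :=
  Algebra.FinitePresentation.quotient (relIdeal_fg x σ)

/-- `C` is of finite presentation over `R` when `B` is. -/
instance SymK.finitePresentation_R [Algebra.FinitePresentation R B] :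
    Algebra.FinitePresentation R (SymK x σ) :=
  Algebra.FinitePresentation.trans R B (SymK x σ)

section
include hσ

/-- `C` is smooth over `R` when `B` is. [cite: StacksProject, Tag 07CH (proof)] -/
theorem SymK.smooth [Algebra.Smooth R B] : Algebra.Smooth R (SymK x σ) :=
  haveI : Algebra.Smooth B (SymK x σ) := ⟨SymK.formallySmooth x σ hσ, inferInstance⟩
  Algebra.Smooth.comp R B (SymK x σ)

end

/-! ### The augmentation `ε : C → B`, `y ↦ 0` -/

/-- The augmentation `ε : C → B`, `y_j ↦ 0`. [cite: StacksProject, Tag 07CH (proof)] -/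
def augment : SymK x σ →ₐ[B] B :=
  Ideal.Quotient.liftₐ (relIdeal x σ) (MvPolynomial.aeval fun _ => (0 : B)) (by
    intro f hf
    refine Submodule.span_induction ?_ (map_zero _)
      (fun a b _ _ ha hb => by rw [map_add, ha, hb, add_zero])
      (fun a b _ hb => by rw [smul_eq_mul, map_mul, hb, mul_zero]) hf
    rintro _ ⟨m, rfl⟩
    simp only [linForm_apply, map_sum, map_smul, MvPolynomial.aeval_X, smul_zero,
      Finset.sum_const_zero])

/-- `ε ∘ q` is evaluation at `y = 0`. [cite: StacksProject, Tag 07CH (proof)] -/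
theorem augment_mk (f : MvPolynomial (Fin n) B) :
    augment x σ (SymK.mkₐ x σ f) = MvPolynomial.aeval (fun _ => (0 : B)) f := rfl

/-- `ε(y_j) = 0`. [cite: StacksProject, Tag 07CH (proof)] -/
@[simp]
theorem augment_yC (j : Fin n) : augment x σ (yC x σ j) = 0 := by
  rw [yC, augment_mk, MvPolynomial.aeval_X]

/-- `ε` is a retraction of `B → C`. [cite: StacksProject, Tag 07CH (proof)] -/
@[simp]
theorem augment_algebraMap (b : B) : augment x σ (algebraMap B (SymK x σ) b) = b :=
  AlgHom.commutes _ b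

/-- `ε(x_j) = x_j`. [cite: StacksProject, Tag 07CH (proof)] -/
@[simp]
theorem augment_xC (j : Fin n) : augment x σ (xC x σ j) = x j :=
  augment_algebraMap x σ (x j)

end Algebra

/-! ## The derivations `D_i` of `C` and the matrix `(D_i z_j)` -/

section Derivations

open KaehlerDifferential

variable {R : Type u} [CommRing R] {B : Type u} [CommRing B] [Algebra R B] {n : ℕ}
  (x : Fin n → B) (σ : Ω[B⁄R] →ₗ[B] (Fin n → B))

/-- The `R`-derivation `∂_i ⊗ 1 + ∂/∂y_i` of `B[y]`. [cite: StacksProject, Tag 07CH (proof)] -/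
def polyDeriv (i : Fin n) : Derivation R (MvPolynomial (Fin n) B) (MvPolynomial (Fin n) B) :=
  coeffwiseDerivation (coordDeriv σ i) + (MvPolynomial.pderiv i).restrictScalars R

/-- `(∂_i ⊗ 1 + ∂/∂y_i)(b) = ∂_i(b)`. [cite: StacksProject, Tag 07CH (proof)] -/
theorem polyDeriv_C (i : Fin n) (b : B) : polyDeriv σ i (C b) = C (coordDeriv σ i b) := by
  rw [polyDeriv, Derivation.add_apply, coeffwiseDerivation_C, Derivation.restrictScalars_apply,
    pderiv_C, add_zero]

/-- `(∂_i ⊗ 1 + ∂/∂y_i)(y_j) = δ_{ij}`. [cite: StacksProject, Tag 07CH (proof)] -/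
theorem polyDeriv_X (i j : Fin n) :
    polyDeriv σ i (X j : MvPolynomial (Fin n) B) = if j = i then 1 else 0 := by
  classical
  rw [polyDeriv, Derivation.add_apply, coeffwiseDerivation_X, Derivation.restrictScalars_apply,
    pderiv_X, zero_add, Pi.single_apply]

/-- Evaluation at `y = 0`. [folklore] -/
abbrev evalZero : MvPolynomial (Fin n) B →ₐ[B] B := MvPolynomial.aeval fun _ => (0 : B)

/-- `(∂_i ⊗ 1 + ∂/∂y_i)(b)` at `y = 0`. [cite: StacksProject, Tag 07CH (proof)] -/
theorem evalZero_polyDeriv_C (i : Fin n) (b : B) :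
    evalZero (polyDeriv σ i (C b)) = coordDeriv σ i b := by
  rw [polyDeriv_C, MvPolynomial.aeval_C, Algebra.algebraMap_self, RingHom.id_apply]

/-- `(∂_i ⊗ 1 + ∂/∂y_i)(y_j)` at `y = 0`. [cite: StacksProject, Tag 07CH (proof)] -/
theorem evalZero_polyDeriv_X (i j : Fin n) :
    evalZero (polyDeriv σ i (X j : MvPolynomial (Fin n) B)) = if j = i then 1 else 0 := by
  rw [polyDeriv_X]
  split_ifs <;> simp

/-- `(∂_i ⊗ 1 + ∂/∂y_i)(b y_l)` at `y = 0` is `b δ_{il}`. [cite: StacksProject, Tag 07CH (proof)] -/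
theorem evalZero_polyDeriv_smul_X (i l : Fin n) (b : B) :
    evalZero (polyDeriv σ i (b • (X l : MvPolynomial (Fin n) B))) = if l = i then b else 0 := by
  rw [MvPolynomial.smul_eq_C_mul, Derivation.leibniz, smul_eq_mul, smul_eq_mul, map_add, map_mul,
    map_mul, evalZero_polyDeriv_X, MvPolynomial.aeval_X, zero_mul, add_zero, MvPolynomial.aeval_C,
    Algebra.algebraMap_self, RingHom.id_apply]
  split_ifs <;> simp

variable (hσ : ∀ ω, ∑ i, σ ω i • D R B (x i) = ω)
include hσ

/-- The `R`-derivations `D_i = q ∘ (∂_i ⊗ 1 + ∂/∂y_i) ∘ φ̄` of `C`. [cite: StacksProject, Tag 07CH (proof)] -/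
def symKDeriv (i : Fin n) : Derivation R (SymK x σ) (SymK x σ) :=
  retractDerivation (polyDeriv σ i) ((retractLift x σ hσ).restrictScalars R)
    ((SymK.mkₐ x σ).restrictScalars R) (mkₐ_retractLift x σ hσ)

/-- `D_i(q f) = q((∂_i ⊗ 1 + ∂/∂y_i)(φ f))`. [cite: StacksProject, Tag 07CH (proof)] -/
theorem symKDeriv_mk (i : Fin n) (f : MvPolynomial (Fin n) B) :
    symKDeriv x σ hσ i (SymK.mkₐ x σ f) = SymK.mkₐ x σ (polyDeriv σ i (retractEndo x σ f)) := rfl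

/-- `ε(D_i z_j) = δ_{ij}`: the matrix `(D_i z_j)` is the identity modulo `(y)` (Stacks:
"`dz_i = dx_i` modulo `Σ B'dy_j + (y_1, …, y_c)Ω`"). [cite: StacksProject, Tag 07CH (proof)] -/
theorem augment_symKDeriv_zC (i j : Fin n) :
    augment x σ (symKDeriv x σ hσ i (zC x σ j)) = if i = j then 1 else 0 := by
  rw [zC_eq, symKDeriv_mk, augment_mk, map_add, MvPolynomial.algHom_C, MvPolynomial.algebraMap_eq,
    retractEndo_X, linForm_apply]
  simp only [map_add, map_sub, map_sum, evalZero_polyDeriv_C, evalZero_polyDeriv_X,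
    evalZero_polyDeriv_smul_X, Finset.sum_ite_eq', Finset.mem_univ, if_true, coordDeriv_x]
  by_cases h : i = j
  · subst h; simp
  · rw [if_neg h, if_neg (Ne.symm h)]; ring

/-- The matrix `Z = (D_i z_j)`. [cite: StacksProject, Tag 07CH (proof)] -/
def ZMat : Matrix (Fin n) (Fin n) (SymK x σ) := Matrix.of fun i j => symKDeriv x σ hσ i (zC x σ j)

/-- Entries of `Z`. [cite: StacksProject, Tag 07CH (proof)] -/
theorem ZMat_apply (i j : Fin n) : ZMat x σ hσ i j = symKDeriv x σ hσ i (zC x σ j) := rfl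

/-- `ε(det Z) = 1`. [cite: StacksProject, Tag 07CH (proof)] -/
theorem augment_det_ZMat : augment x σ (ZMat x σ hσ).det = 1 := by
  rw [AlgHom.map_det]
  convert Matrix.det_one (n := Fin n) (R := B)
  ext i j
  rw [AlgHom.mapMatrix_apply, Matrix.map_apply, ZMat_apply, augment_symKDeriv_zC, Matrix.one_apply]

end Derivations

/-! ## `Ω_{C/R}` is generated by the `dz_j` up to an element of `1 + (y)` (Nakayama) -/

section Kaehler

open KaehlerDifferential

variable {R : Type u} [CommRing R] {B : Type u} [CommRing B] [Algebra R B] {n : ℕ}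
  (x : Fin n → B) (σ : Ω[B⁄R] →ₗ[B] (Fin n → B))

/-- The span `N` of the `dz_j` in `Ω_{C/R}`. [cite: StacksProject, Tag 07CH (proof)] -/
def dzSpan : Submodule (SymK x σ) Ω[SymK x σ⁄R] :=
  Submodule.span (SymK x σ) (Set.range fun j => D R (SymK x σ) (zC x σ j))

/-- `dz_j ∈ N`. [cite: StacksProject, Tag 07CH (proof)] -/
theorem D_zC_mem_dzSpan (j : Fin n) : D R (SymK x σ) (zC x σ j) ∈ dzSpan x σ :=
  Submodule.subset_span ⟨j, rfl⟩

/-- `d(b) = Σ_i ∂_i(b) dx_i` in `Ω_{C/R}`, for `b ∈ B`. [cite: StacksProject, Tag 07CH (proof)] -/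
theorem D_algebraMap_eq_sum (hσ : ∀ ω, ∑ i, σ ω i • D R B (x i) = ω) (b : B) :
    D R (SymK x σ) (algebraMap B (SymK x σ) b) =
      ∑ i, algebraMap B (SymK x σ) (coordDeriv σ i b) • D R (SymK x σ) (xC x σ i) := by
  have h := congrArg (KaehlerDifferential.map R R B (SymK x σ)) (hσ (D R B b))
  rw [KaehlerDifferential.map_D] at h
  rw [← h, map_sum]
  refine Finset.sum_congr rfl fun i _ => ?_
  rw [map_smul, KaehlerDifferential.map_D, algebraMap_smul]
  rfl

/-- `dx_m = Σ_i P_{im} dx_i` in `Ω_{C/R}`. [cite: StacksProject, Tag 07CH (proof)] -/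
theorem D_xC_eq_sum (hσ : ∀ ω, ∑ i, σ ω i • D R B (x i) = ω) (m : Fin n) :
    D R (SymK x σ) (xC x σ m) =
      ∑ i, algebraMap B (SymK x σ) (projMat x σ i m) • D R (SymK x σ) (xC x σ i) :=
  D_algebraMap_eq_sum x σ hσ (x m)

/-- `Σ_l P_{lm} dy_l = - Σ_l y_l dP_{lm}` in `Ω_{C/R}`. [cite: StacksProject, Tag 07CH (proof)] -/
theorem sum_projMat_smul_D_yC (m : Fin n) :
    ∑ l, algebraMap B (SymK x σ) (projMat x σ l m) • D R (SymK x σ) (yC x σ l) =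
      -∑ l, yC x σ l • D R (SymK x σ) (algebraMap B (SymK x σ) (projMat x σ l m)) := by
  have h := congrArg (D R (SymK x σ)) (sum_projMat_smul_yC x σ m)
  rw [map_zero, map_sum] at h
  simp only [Algebra.smul_def, Derivation.leibniz, Finset.sum_add_distrib] at h
  rw [eq_neg_iff_add_eq_zero]
  simpa only [smul_eq_mul] using h

variable (hσ : ∀ ω, ∑ i, σ ω i • D R B (x i) = ω)
include hσ

/-- `dx_m ∈ N + (y)Ω`. [cite: StacksProject, Tag 07CH (proof)] -/
theorem D_xC_mem (m : Fin n) :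
    D R (SymK x σ) (xC x σ m) ∈ dzSpan x σ ⊔ (RingHom.ker (augment x σ)) • ⊤ := by
  have h1 : D R (SymK x σ) (xC x σ m) =
      ∑ l, algebraMap B (SymK x σ) (projMat x σ l m) • D R (SymK x σ) (zC x σ l) +
        ∑ l, yC x σ l • D R (SymK x σ) (algebraMap B (SymK x σ) (projMat x σ l m)) := by
    have h2 : ∀ l, D R (SymK x σ) (zC x σ l) = D R (SymK x σ) (xC x σ l) + D R (SymK x σ) (yC x σ l) :=
      fun l => by rw [zC, map_add]
    simp only [h2, smul_add, Finset.sum_add_distrib]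
    rw [sum_projMat_smul_D_yC, ← D_xC_eq_sum x σ hσ m, neg_add_cancel_right]
  rw [h1]
  refine Submodule.add_mem_sup (Submodule.sum_mem _ fun l _ => Submodule.smul_mem _ _
    (D_zC_mem_dzSpan x σ l)) (Submodule.sum_mem _ fun l _ => ?_)
  refine Submodule.smul_mem_smul ?_ Submodule.mem_top
  rw [RingHom.mem_ker]
  exact augment_yC x σ l

/-- `dy_m ∈ N + (y)Ω`. [cite: StacksProject, Tag 07CH (proof)] -/
theorem D_yC_mem (m : Fin n) :
    D R (SymK x σ) (yC x σ m) ∈ dzSpan x σ ⊔ (RingHom.ker (augment x σ)) • ⊤ := by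
  have h : D R (SymK x σ) (yC x σ m) = D R (SymK x σ) (zC x σ m) - D R (SymK x σ) (xC x σ m) := by
    rw [zC, map_add, add_sub_cancel_left]
  rw [h]
  exact Submodule.sub_mem _ (Submodule.mem_sup_left (D_zC_mem_dzSpan x σ m)) (D_xC_mem x σ hσ m)

/-- `Ω_{C/R} = N + (y)Ω_{C/R}` (Stacks: "we conclude that `Ω_{B'/R[z]}/(y)Ω_{B'/R[z]} = 0`").
[cite: StacksProject, Tag 07CH (proof)] -/
theorem mem_dzSpan_sup (ω : Ω[SymK x σ⁄R]) :
    ω ∈ dzSpan x σ ⊔ (RingHom.ker (augment x σ)) • ⊤ := by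
  have key : Submodule.span (SymK x σ) (Set.range (D R (SymK x σ))) ≤
      dzSpan x σ ⊔ (RingHom.ker (augment x σ)) • ⊤ := by
    rw [Submodule.span_le]
    rintro _ ⟨c, rfl⟩
    obtain ⟨f, rfl⟩ := SymK.mkₐ_surjective x σ c
    induction f using MvPolynomial.induction_on with
    | C b =>
      rw [← SymK.algebraMap_eq, D_algebraMap_eq_sum x σ hσ]
      exact Submodule.sum_mem _ fun i _ => Submodule.smul_mem _ _ (D_xC_mem x σ hσ i)
    | add p q hp hq => rw [map_add, map_add]; exact add_mem hp hq
    | mul_X p i hp =>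
      rw [map_mul, Derivation.leibniz]
      exact add_mem (Submodule.smul_mem _ _ (D_yC_mem x σ hσ i)) (Submodule.smul_mem _ _ hp)
  exact key (by rw [KaehlerDifferential.span_range_derivation]; exact Submodule.mem_top)

/-- **Nakayama step.** There is `r ∈ C` with `ε(r) = 1` and `r Ω_{C/R} ⊆ N = Σ_j C dz_j` (Stacks:
"by Nakayama's lemma there exists a `g ∈ 1 + (y_1, …, y_c)` that `(Ω_{B'/R[z]})_g = 0`").
[cite: StacksProject, Tag 07CH (proof)] -/
theorem exists_augment_eq_one_and_smul_mem [Algebra.FinitePresentation R B] :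
    ∃ r : SymK x σ, augment x σ r = 1 ∧ ∀ ω : Ω[SymK x σ⁄R], r • ω ∈ dzSpan x σ := by
  set N := dzSpan x σ
  set I := RingHom.ker (augment x σ)
  have hfg : (⊤ : Submodule (SymK x σ) (Ω[SymK x σ⁄R] ⧸ N)).FG := Module.Finite.fg_top
  have hle : (⊤ : Submodule (SymK x σ) (Ω[SymK x σ⁄R] ⧸ N)) ≤ I • ⊤ := by
    rintro q -
    obtain ⟨ω, rfl⟩ := N.mkQ_surjective q
    obtain ⟨a, ha, t, ht, rfl⟩ := Submodule.mem_sup.mp (mem_dzSpan_sup x σ hσ ω)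
    have ha0 : N.mkQ a = 0 := by rwa [← LinearMap.mem_ker, Submodule.ker_mkQ]
    rw [map_add, ha0, zero_add]
    have : N.mkQ t ∈ (I • (⊤ : Submodule (SymK x σ) Ω[SymK x σ⁄R])).map N.mkQ :=
      Submodule.mem_map_of_mem ht
    rw [Submodule.map_smul''] at this
    exact Submodule.smul_mono le_rfl le_top this
  obtain ⟨r, hr1, hr⟩ := Submodule.exists_sub_one_mem_and_smul_eq_zero_of_fg_of_le_smul I ⊤ hfg hle
  refine ⟨r, ?_, fun ω => ?_⟩
  · rw [RingHom.mem_ker, map_sub, map_one, sub_eq_zero] at hr1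
    exact hr1
  · have h := hr (N.mkQ ω) Submodule.mem_top
    rw [← map_smul, Submodule.mkQ_apply, Submodule.Quotient.mk_eq_zero] at h
    exact h

end Kaehler

/-! ## The standard smooth localisation `S = C_g`, `g = r · det(D_i z_j)` -/

section Localize

open KaehlerDifferential

variable {R : Type u} [CommRing R] {B : Type u} [CommRing B] [Algebra R B] {n : ℕ}
  (x : Fin n → B) (σ : Ω[B⁄R] →ₗ[B] (Fin n → B))
  (hσ : ∀ ω, ∑ i, σ ω i • D R B (x i) = ω) [Algebra.FinitePresentation R B]

/-- The Nakayama element `r ∈ 1 + (y)` with `r Ω_{C/R} ⊆ Σ_j C dz_j`. [cite: StacksProject, Tag 07CH (proof)] -/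
def nakElem : SymK x σ := (exists_augment_eq_one_and_smul_mem x σ hσ).choose

/-- `ε(r) = 1`. [cite: StacksProject, Tag 07CH (proof)] -/
theorem augment_nakElem : augment x σ (nakElem x σ hσ) = 1 :=
  (exists_augment_eq_one_and_smul_mem x σ hσ).choose_spec.1

/-- `r ω ∈ N` for all `ω`. [cite: StacksProject, Tag 07CH (proof)] -/
theorem nakElem_smul_mem (ω : Ω[SymK x σ⁄R]) : nakElem x σ hσ • ω ∈ dzSpan x σ :=
  (exists_augment_eq_one_and_smul_mem x σ hσ).choose_spec.2 ω

/-- The element `g = r · det(D_i z_j)` to be inverted. [cite: StacksProject, Tag 07CH (proof)] -/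
def gElem : SymK x σ := nakElem x σ hσ * (ZMat x σ hσ).det

/-- `ε(g) = 1`. [cite: StacksProject, Tag 07CH (proof)] -/
theorem augment_gElem : augment x σ (gElem x σ hσ) = 1 := by
  rw [gElem, map_mul, augment_nakElem, augment_det_ZMat, mul_one]

/-- The localisation `S = C_g`. [cite: StacksProject, Tag 07CH (proof)] -/
abbrev Sg : Type u := Localization.Away (gElem x σ hσ)

/-- `r` is a unit in `S = C_g`. [cite: StacksProject, Tag 07CH (proof)] -/
theorem isUnit_algebraMap_nakElem :
    IsUnit (algebraMap (SymK x σ) (Sg x σ hσ) (nakElem x σ hσ)) :=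
  isUnit_of_dvd_unit (map_dvd _ (Dvd.intro _ rfl))
    (IsLocalization.Away.algebraMap_isUnit (S := Sg x σ hσ) (gElem x σ hσ))

/-- `det Z` is a unit in `S = C_g`. [cite: StacksProject, Tag 07CH (proof)] -/
theorem isUnit_algebraMap_det_ZMat :
    IsUnit (algebraMap (SymK x σ) (Sg x σ hσ) (ZMat x σ hσ).det) :=
  isUnit_of_dvd_unit (map_dvd _ (Dvd.intro_left _ rfl))
    (IsLocalization.Away.algebraMap_isUnit (S := Sg x σ hσ) (gElem x σ hσ))

/-- `S` is smooth over `R` when `B` is. [cite: StacksProject, Tag 07CH (proof)] -/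
theorem Sg.smooth [Algebra.Smooth R B] : Algebra.Smooth R (Sg x σ hσ) :=
  haveI := SymK.smooth x σ hσ
  haveI : Algebra.Smooth (SymK x σ) (Sg x σ hσ) := Algebra.Smooth.of_isLocalization_Away (gElem x σ hσ)
  Algebra.Smooth.comp R (SymK x σ) (Sg x σ hσ)

/-- `S` is of finite presentation over `R`. -/
instance Sg.finitePresentation : Algebra.FinitePresentation R (Sg x σ hσ) :=
  haveI : Algebra.FinitePresentation (SymK x σ) (Sg x σ hσ) :=
    IsLocalization.Away.finitePresentation (gElem x σ hσ)
  Algebra.FinitePresentation.trans R (SymK x σ) (Sg x σ hσ)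

/-- The elements `w_j = d(z_j/1) ∈ Ω_{S/R}`. [cite: StacksProject, Tag 07CH (proof)] -/
def wVec (j : Fin n) : Ω[Sg x σ hσ⁄R] :=
  D R (Sg x σ hσ) (algebraMap (SymK x σ) (Sg x σ hσ) (zC x σ j))

/-- `w_j` is the image of `dz_j`. [cite: StacksProject, Tag 07CH (proof)] -/
theorem map_D_zC (j : Fin n) :
    KaehlerDifferential.map R R (SymK x σ) (Sg x σ hσ) (D R (SymK x σ) (zC x σ j)) = wVec x σ hσ j :=
  KaehlerDifferential.map_D _ _ _ _ _

/-- `N` maps into the span of the `w_j`. [cite: StacksProject, Tag 07CH (proof)] -/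
theorem map_mem_span_wVec {ω : Ω[SymK x σ⁄R]} (hω : ω ∈ dzSpan x σ) :
    KaehlerDifferential.map R R (SymK x σ) (Sg x σ hσ) ω ∈
      Submodule.span (Sg x σ hσ) (Set.range (wVec x σ hσ)) := by
  have h : dzSpan x σ ≤ ((Submodule.span (Sg x σ hσ) (Set.range (wVec x σ hσ))).restrictScalars
      (SymK x σ)).comap (KaehlerDifferential.map R R (SymK x σ) (Sg x σ hσ)) := by
    rw [dzSpan, Submodule.span_le]
    rintro _ ⟨j, rfl⟩
    change KaehlerDifferential.map R R (SymK x σ) (Sg x σ hσ) (D R (SymK x σ) (zC x σ j)) ∈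
      Submodule.span (Sg x σ hσ) (Set.range (wVec x σ hσ))
    rw [map_D_zC]
    exact Submodule.subset_span ⟨j, rfl⟩
  exact h hω

/-- The `w_j` span `Ω_{S/R}` (Nakayama, `r` being a unit in `S`). [cite: StacksProject, Tag 07CH (proof)] -/
theorem span_wVec : Submodule.span (Sg x σ hσ) (Set.range (wVec x σ hσ)) = ⊤ := by
  apply top_le_iff.mp
  rw [← KaehlerDifferential.span_range_map_derivation_of_isLocalization R (SymK x σ) (Sg x σ hσ)
    (.powers (gElem x σ hσ)), Submodule.span_le]
  rintro _ ⟨c, rfl⟩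
  have hu := isUnit_algebraMap_nakElem x σ hσ
  have hmem : algebraMap (SymK x σ) (Sg x σ hσ) (nakElem x σ hσ) •
      KaehlerDifferential.map R R (SymK x σ) (Sg x σ hσ) (D R (SymK x σ) c) ∈
        Submodule.span (Sg x σ hσ) (Set.range (wVec x σ hσ)) := by
    rw [algebraMap_smul, ← map_smul]
    exact map_mem_span_wVec x σ hσ (nakElem_smul_mem x σ hσ _)
  rw [Function.comp_apply, SetLike.mem_coe, ← inv_smul_smul hu.unit
    (KaehlerDifferential.map R R (SymK x σ) (Sg x σ hσ) (D R (SymK x σ) c))]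
  refine Submodule.smul_mem _ _ ?_
  rw [Units.smul_def, IsUnit.unit_spec]
  exact hmem

/-- The `w_j` are linearly independent (the derivations `D_i`, extended to `S`, have an
invertible matrix on the `z_j`). [cite: StacksProject, Tag 07CH (proof)] -/
theorem linearIndependent_wVec : LinearIndependent (Sg x σ hσ) (wVec x σ hσ) := by
  haveI : Algebra.FormallyEtale (SymK x σ) (Sg x σ hσ) :=
    Algebra.FormallyEtale.of_isLocalization (.powers (gElem x σ hσ))
  have hbc : IsBaseChange (Sg x σ hσ) (KaehlerDifferential.map R R (SymK x σ) (Sg x σ hσ)) :=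
    KaehlerDifferential.isBaseChange_of_formallyEtale R (SymK x σ) (Sg x σ hσ)
  let Ψ : Fin n → (Ω[Sg x σ hσ⁄R] →ₗ[Sg x σ hσ] Sg x σ hσ) := fun i =>
    hbc.lift ((Algebra.linearMap (SymK x σ) (Sg x σ hσ)).comp
      ((symKDeriv x σ hσ i).liftKaehlerDifferential.restrictScalars (SymK x σ)))
  have hΨ : ∀ i j, Ψ i (wVec x σ hσ j) = algebraMap (SymK x σ) (Sg x σ hσ) (ZMat x σ hσ i j) := by
    intro i j
    rw [← map_D_zC, hbc.lift_eq, LinearMap.comp_apply, LinearMap.restrictScalars_apply,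
      Derivation.liftKaehlerDifferential_comp_D, Algebra.linearMap_apply, ZMat_apply]
  set Z' : Matrix (Fin n) (Fin n) (Sg x σ hσ) :=
    (algebraMap (SymK x σ) (Sg x σ hσ)).mapMatrix (ZMat x σ hσ) with hZ'
  have hdet : IsUnit Z'.det := by
    rw [hZ', ← RingHom.map_det]
    exact isUnit_algebraMap_det_ZMat x σ hσ
  rw [Fintype.linearIndependent_iff]
  intro s hs i₀
  have hZ : Z'.mulVec s = 0 := by
    funext i
    have h := congrArg (Ψ i) hs
    rw [map_sum, map_zero] at h
    simp only [map_smul, hΨ, smul_eq_mul] at h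
    rw [Matrix.mulVec, dotProduct, Pi.zero_apply, ← h]
    refine Finset.sum_congr rfl fun j _ => ?_
    rw [hZ', RingHom.mapMatrix_apply, Matrix.map_apply, mul_comm]
  have hs0 : s = 0 := by
    calc s = (Z'⁻¹ * Z').mulVec s := by rw [Matrix.nonsing_inv_mul _ hdet, Matrix.one_mulVec]
      _ = 0 := by rw [← Matrix.mulVec_mulVec, hZ, Matrix.mulVec_zero]
  exact congrFun hs0 i₀

/-- The basis `(d z_j)_j` of `Ω_{S/R}`. [cite: StacksProject, Tag 07CH (proof)] -/
def basisSg : Module.Basis (Fin n) (Sg x σ hσ) Ω[Sg x σ hσ⁄R] :=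
  Module.Basis.mk (linearIndependent_wVec x σ hσ) (by rw [span_wVec])

/-- The basis vectors are the `w_j = d(z_j)`. [cite: StacksProject, Tag 07CH (proof)] -/
theorem basisSg_apply (j : Fin n) : basisSg x σ hσ j = wVec x σ hσ j := by
  rw [basisSg, Module.Basis.coe_mk]

/-- **`S = C_g` is standard smooth over `R`** (Mathlib's criterion: `Ω_{S/R}` free on exact
differentials and `H¹(L_{S/R}) = 0`). [cite: StacksProject, Tag 07CH] -/
theorem Sg.isStandardSmooth [Algebra.Smooth R B] : Algebra.IsStandardSmooth R (Sg x σ hσ) := by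
  haveI := Sg.smooth x σ hσ
  refine Algebra.IsStandardSmooth.of_basis_kaehlerDifferential (basisSg x σ hσ) ?_
  rintro _ ⟨j, rfl⟩
  exact ⟨algebraMap (SymK x σ) (Sg x σ hσ) (zC x σ j), (basisSg_apply x σ hσ j).symm⟩

/-- The retraction `ρ : S → B` extending the augmentation (`ε(g) = 1`). [cite: StacksProject, Tag 07CH (proof)] -/
def retractionSg : Sg x σ hσ →ₐ[R] B :=
  IsLocalization.Away.liftAlgHom (S := Sg x σ hσ) (gElem x σ hσ)
    (f := (augment x σ).restrictScalars R) (by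
      rw [AlgHom.restrictScalars_apply, augment_gElem]; exact isUnit_one)

/-- `ρ` is a retraction of `B → S`. [cite: StacksProject, Tag 07CH (proof)] -/
theorem retractionSg_algebraMap (b : B) :
    retractionSg x σ hσ (algebraMap B (Sg x σ hσ) b) = b := by
  rw [IsScalarTower.algebraMap_apply B (SymK x σ) (Sg x σ hσ), retractionSg,
    IsLocalization.Away.liftAlgHom_apply, IsLocalization.Away.lift_eq]
  exact augment_algebraMap x σ b

end Localize

end Stacks07CH

/-! ## Stacks 07CH (retract form) and 07CI -/

section Main

open KaehlerDifferential

/-- **Stacks, Lemma 07CH** (in retract form): a smooth `R`-algebra `B` admits `R`-algebra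
maps `ι : B → S`, `ρ : S → B` with `ρ ∘ ι = id` and `S` standard smooth over `R`.
[cite: StacksProject, Tag 07CH] -/
theorem exists_isStandardSmooth_retract_of_smooth (R B : Type u) [CommRing R] [CommRing B]
    [Algebra R B] [Algebra.Smooth R B] :
    ∃ (S : Type u) (_ : CommRing S) (_ : Algebra R S), Algebra.IsStandardSmooth R S ∧
      ∃ (ι : B →ₐ[R] S) (ρ : S →ₐ[R] B), ρ.comp ι = AlgHom.id R B := by
  obtain ⟨n, f, hf, -⟩ := Algebra.FinitePresentation.out (R := R) (A := B)
  let x : Fin n → B := fun i => f (X i)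
  let π : (Fin n → B) →ₗ[B] Ω[B⁄R] := Fintype.linearCombination B fun i => D R B (x i)
  have hπ : Function.Surjective π := by
    rw [← LinearMap.range_eq_top, Fintype.range_linearCombination]
    exact span_range_D_eq_top_of_surjective f hf
  obtain ⟨σ, hσ'⟩ := Module.projective_lifting_property π LinearMap.id hπ
  have hσ : ∀ ω, ∑ i, σ ω i • D R B (x i) = ω := fun ω => by
    have h := LinearMap.congr_fun hσ' ω
    rwa [LinearMap.comp_apply, Fintype.linearCombination_apply, LinearMap.id_apply] at h
  refine ⟨Stacks07CH.Sg x σ hσ, inferInstance, inferInstance, Stacks07CH.Sg.isStandardSmooth x σ hσ,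
    IsScalarTower.toAlgHom R B (Stacks07CH.Sg x σ hσ), Stacks07CH.retractionSg x σ hσ, ?_⟩
  ext b
  exact Stacks07CH.retractionSg_algebraMap x σ hσ b

/-- **Stacks, Lemma 07CI** (factorisation form): if every finite type `A → Λ` factors through a
smooth `R`-algebra, then every finitely presented `A → Λ` factors through a standard smooth
`R`-algebra ("Choose an `R`-algebra map `B → C` with a retraction `C → B` such that `C` is
standard smooth over `R`, see Lemma 07CH. Then the desired factorization is
`A → B → C → B → Λ`."). This is hypothesis `hCI` of `Stacks07F5_reduceToField_of`.
[cite: StacksProject, Tag 07CI] -/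
theorem hasStandardSmoothFactorizations_of_hasSmoothFactorizations {R Λ : Type u} [CommRing R]
    [CommRing Λ] [Algebra R Λ] (h : HasSmoothFactorizations R Λ) :
    HasStandardSmoothFactorizations R Λ := by
  intro A _ _ _ φ
  obtain ⟨C, _, _, hC, v, w, hvw⟩ := h A inferInstance φ
  haveI := hC
  obtain ⟨S, _, _, hS, ι, ρ, hρι⟩ := exists_isStandardSmooth_retract_of_smooth R C
  refine ⟨S, inferInstance, inferInstance, hS, ι.comp v, w.comp ρ, ?_⟩
  ext a
  have h1 := AlgHom.congr_fun hρι (v a)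
  rw [AlgHom.comp_apply, AlgHom.id_apply] at h1
  rw [AlgHom.comp_apply, AlgHom.comp_apply, AlgHom.comp_apply, h1, ← AlgHom.comp_apply, hvw]

end Main

end Literature.AlgebraicGeometry.Resolution
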